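import Summits.NavierStokesRegularity.NavierStokesRegularity.Theses.SqueezeCycle
import Summits.NavierStokesRegularity.NavierStokesRegularity.Theorems.SqueezeCycleExtremalBiaxialitySubcriticalOfLiouville
import Summits.NavierStokesRegularity.NavierStokesRegularity.Theorems.SqueezeCycleExtremalBiaxialitySubcriticalReductions
import Summits.NavierStokesRegularity.NavierStokesRegularity.Theorems.SqueezeCycleExtremalBiaxialitySubcriticalExtremal
import Summits.NavierStokesRegularity.NavierStokesRegularity.Theorems.SqueezeCycleExtremalElementExists
import Summits.NavierStokesRegularity.NavierStokesRegularity.Theorems.SqueezeCycleStrainAlgebra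
import Summits.NavierStokesRegularity.NavierStokesRegularity.Theorems.SqueezeCycleMustSqueezeAlgebra
import Summits.NavierStokesRegularity.NavierStokesRegularity.Theorems.SqueezeCycleExtremalBiaxialitySubcriticalGaugeStrainBound
import Summits.NavierStokesRegularity.NavierStokesRegularity.Theorems.SqueezeCycleExtremalBiaxialitySubcriticalCubicProductionBound
import Summits.NavierStokesRegularity.NavierStokesRegularity.Theorems.SqueezeCycleExtremalBiaxialitySubcriticalLeakyQuarterLawCeiling
import Literature.Analysis.FluidPDE.TypeIAncientMild
import Literature.Analysis.FluidPDE.LerayGaugeStrainSpectrum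
import HarnessLib

/-!
# Crux `ExtremalBiaxialitySubcritical` (stmt-NavierStokesRegularity-11609) — line `quarter-bootstrap-pinning`, lead skeleton

Lead skeleton of line `quarter-bootstrap-pinning` (card: crux idea `quarter-bootstrap-pinning`,
ideator 3; crux-plan skeleton registered 2026-08-15T23:59:21Z, sha 994055e8). Rebuilt by the line
lead VERBATIM from the four stub signatures registered on the ledger (the planner's skeleton file is
not readable from the lead's jail); the composition `ExtremalBiaxialitySubcritical_of` is the lead's.

The line: the maximality clause of the crux ("`Λ_v ≤ m` on all of `𝒦_C`") is a middle-eigenvalue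
CEILING at the attained value `m` itself, which — through the class-uniform gauge strain bound
`|𝔖| ≤ K(C)` (`stub_gaugeStrainBound`) and the exact cubic production identity
`−4 det 𝔖 = 2Λ|𝔖|² − 4Λ³` (`stub_cubicProductionBound`) — is a PRODUCTION ceiling
`−4 det 𝔖 ≤ 2b|𝔖|²` with `b = m − 2m³/K²`; if `b < ¼` the leaky quarter law
(`stub_leakyQuarterLawCeiling`, the sibling crux `MustSqueeze`'s engine at every threshold `< ¼`)
makes the extremal element vanish, so `∇u(t₀,·) = 0` and `m ≤ 0 < 1/8`; the complementary regime
`b ≥ ¼` is the open stub `stub_largeExcessExclusion` (the crux at attained `m ≳ ¼`).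

Registered stubs (`stub_*`; the single open one is the only `sorry`):
* `stub_gaugeStrainBound`      — LANDED p72389 (KNSS (4.6) k = 1 on the class + zoom + Frobenius ≤ 3 op²).
* `stub_cubicProductionBound`  — LANDED p72572 (pure algebra over `production_identity`, `six_mul_midStrain_sq_le`).
* `stub_leakyQuarterLawCeiling`— LANDED p77091 (MustSqueeze engine in production currency, every b < ¼).
* `stub_largeExcessExclusion`  — OPEN, hardest (held by the lead).
`ExtremalBiaxialitySubcritical_of` composes them into the crux BY NAME (uses all three load-bearing
hypotheses of Disproof §1: `t₀ < 0`, membership, attainment; maximality is spent as the threshold).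
-/

noncomputable section

open MeasureTheory Set Filter Topology
open scoped RealInnerProductSpace Matrix

namespace Summit.NavierStokesRegularity.NavierStokesRegularity.Theorems

open Literature.Analysis.FluidPDE
open Summit.NavierStokesRegularity.NavierStokesRegularity.Theses.SqueezeCycle

/-- Physical space `ℝ³`. -/
local notation "ℝ³" => EuclideanSpace ℝ (Fin 3)

/-! ## Registered stubs -/

/-! ### Landed stubs
* `stub_gaugeStrainBound` — LANDED p72389 (`Theorems/SqueezeCycleExtremalBiaxialitySubcriticalGaugeStrainBound.lean`), imported.
* `stub_cubicProductionBound` — LANDED p72572 (`Theorems/SqueezeCycleExtremalBiaxialitySubcriticalCubicProductionBound.lean`), imported.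
* `stub_leakyQuarterLawCeiling` — LANDED p77091 (`Theorems/SqueezeCycleExtremalBiaxialitySubcriticalLeakyQuarterLawCeiling.lean`, via the
  production-currency lever `stub_signedBudgetProduction` p75887 and the sibling crux `MustSqueeze`'s landed stubs), imported.
-/

/-- **stub_largeExcessExclusion** (OPEN — the hardest stub, held by the lead; it is the crux on
the large-excess regime) — there is no extremal configuration with `1/4 ≤ m − 2m³/K²`: given
`K > 0`, the class-wide gauge strain bound `|S|²_F ≤ (K/(−t))²` together with the class-wide
middle-eigenvalue ceiling `Λ ≤ m` on `𝒦_C`, `0 ≤ m`, `1/4 ≤ m − 2m³/K²`, an element `u ∈ 𝒦_C`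
and a point `(t₀, x₀)`, `t₀ < 0`, with `m ≤ Λ_u(t₀, x₀)` — contradiction. (Card
quarter-bootstrap-pinning: in this regime the extremal squeezer saturates the ¼-law with pinned
middle eigenvalue on nearly planar intense strain; no mechanism excludes it yet. Equivalent, given
the other three stubs, to the crux itself restricted to attained maxima `m ≳ ¼`.) -/
theorem stub_largeExcessExclusion :
    ∀ (C K m : ℝ) (u : ℝ → EuclideanSpace ℝ (Fin 3) → EuclideanSpace ℝ (Fin 3)) (t₀ : ℝ) (x₀ : EuclideanSpace ℝ (Fin 3)), 0 < K → (∀ (v' : ℝ → EuclideanSpace ℝ (Fin 3) → EuclideanSpace ℝ (Fin 3)), ContDiffOn ℝ (⊤ : ℕ∞) (Function.uncurry v') (Set.Iio 0 ×ˢ Set.univ) ∧ (∀ t < 0, Literature.Analysis.FluidPDE.VectorCalculus.IsDivFree (v' t)) ∧ (∀ s t : ℝ, s < t → t < 0 → ∀ x, v' t x = Literature.Analysis.FluidPDE.heatFlow (v' s) (t-s) x - ∫ τ in Set.Ioo s t, ∫ y, ((-(inner ℝ (x-y) (v' τ y) / (2*(t-τ)) * Literature.Analysis.UnboundedOperators.heatKernel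 (t-τ) (x-y))) • v' τ y + (∫ σ in Set.Ioi (t-τ), Literature.Analysis.UnboundedOperators.heatKernel σ (x-y) / (4*σ^2)) • (inner ℝ (x-y) (v' τ y) • v' τ y + inner ℝ (v' τ y) (v' τ y) • (x-y) + inner ℝ (x-y) (v' τ y) • v' τ y) - ((∫ σ in Set.Ioi (t-τ), Literature.Analysis.UnboundedOperators.heatKernel σ (x-y) / (8*σ^3)) * (inner ℝ (x-y) (v' τ y) * inner ℝ (x-y) (v' τ y))) • (x-y))) ∧ Literature.Analysis.FluidPDE.HasTypeITimeDecay C v' ∧ (∀ (x₀ : EuclideanSpace ℝ (Fin 3)) (t₀ r : ℝ), t₀ ≤ 0 → 0 < r → (∀ t, t₀ - r^2 < t → t < t₀ → r⁻¹ * ∫ x in Metric.ball x₀ r, ‖v' t x‖^2 ≤ C) ∧ r⁻¹ * ∫ t in Set.Ioo (t₀ - r^2) t₀, ∫ x in Metric.ball x₀ r, ‖fderiv ℝ (v' t) x‖^2 ≤ C) → ∀ t < 0, ∀ x, (∑ i, ∑ j, (((1 / 2 : ℝ) • (Literature.Analysis.FluidPDE.stdMatrix (fderiv ℝ (v' t)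 x : EuclideanSpace ℝ (Fin 3) →ₗ[ℝ] EuclideanSpace ℝ (Fin 3)) + (Literature.Analysis.FluidPDE.stdMatrix (fderiv ℝ (v' t) x : EuclideanSpace ℝ (Fin 3) →ₗ[ℝ] EuclideanSpace ℝ (Fin 3)))ᵀ)) i j) ^ 2) ≤ (K / (-t)) ^ 2 ∧ Literature.Analysis.FluidPDE.lerayMiddleStrain v' t x ≤ m) → 0 ≤ m → 1 / 4 ≤ m - 2 * m ^ 3 / K ^ 2 → t₀ < 0 → (ContDiffOn ℝ (⊤ : ℕ∞) (Function.uncurry u) (Set.Iio 0 ×ˢ Set.univ) ∧ (∀ t < 0, Literature.Analysis.FluidPDE.VectorCalculus.IsDivFree (u t)) ∧ (∀ s t : ℝ, s < t → t < 0 → ∀ x, u t x = Literature.Analysis.FluidPDE.heatFlow (u s) (t-s) x - ∫ τ in Set.Ioo s t, ∫ y, ((-(inner ℝ (x-y) (u τ y) / (2*(t-τ)) * Literature.Analysis.UnboundedOperators.heatKernel (t-τ) (x-y))) • u τ y + (∫ σ in Set.Ioi (t-τ), Literature.Analysis.UnboundedOperators.heatKernel σ (x-y) / (4*σ^2)) •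 (inner ℝ (x-y) (u τ y) • u τ y + inner ℝ (u τ y) (u τ y) • (x-y) + inner ℝ (x-y) (u τ y) • u τ y) - ((∫ σ in Set.Ioi (t-τ), Literature.Analysis.UnboundedOperators.heatKernel σ (x-y) / (8*σ^3)) * (inner ℝ (x-y) (u τ y) * inner ℝ (x-y) (u τ y))) • (x-y))) ∧ Literature.Analysis.FluidPDE.HasTypeITimeDecay C u ∧ (∀ (x₀ : EuclideanSpace ℝ (Fin 3)) (t₀ r : ℝ), t₀ ≤ 0 → 0 < r → (∀ t, t₀ - r^2 < t → t < t₀ → r⁻¹ * ∫ x in Metric.ball x₀ r, ‖u t x‖^2 ≤ C) ∧ r⁻¹ * ∫ t in Set.Ioo (t₀ - r^2) t₀, ∫ x in Metric.ball x₀ r, ‖fderiv ℝ (u t) x‖^2 ≤ C)) → m ≤ Literature.Analysis.FluidPDE.lerayMiddleStrain u t₀ x₀ → False := by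
  sorry

/-! ## Composition -/

/-- **`ExtremalBiaxialitySubcritical` from the stubs** (line quarter-bootstrap-pinning). Take the
class-uniform strain constant `K = K(C)` (`stub_gaugeStrainBound`); `m ≥ 0` (maximality tested on
`0 ∈ 𝒦_C`, `nonneg_of_maximal`). If `¼ ≤ m − 2m³/K²`, `stub_largeExcessExclusion` (fed with the
strain bound, the ceiling `Λ ≤ m` in `lerayMiddleStrain` form, membership and attainment
`m ≤ Λ_u(t₀,x₀)`) is absurd. Otherwise `b := m − 2m³/K² < ¼`; attainment plus maximality give
`Λ_u(t₀,x₀) = m`, so `6m² ≤ (−t₀)²·(3/2)μ₁² ≤ (−t₀)²|S|² ≤ K²` (`six_mul_midStrain_sq_le`); at every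
`(t,x)` the ceiling `μ₁(M+Mᵀ) ≤ 2m/(−t)` (`lerayMiddleStrain_eq_eigenvalues₀`) and `|S|² ≤ (K/(−t))²`
feed `stub_cubicProductionBound` with `(m/(−t), K/(−t))`, giving the production ceiling
`−4 det S ≤ (2b/(−t))|S|²`; `stub_leakyQuarterLawCeiling` kills `u`, and the attainment clause on the
zero slice forces `m ≤ 0 < 1/8` (`nonpos_of_twoFrame_lower_of_slice_zero`). -/
theorem ExtremalBiaxialitySubcritical_of :
    Summit.NavierStokesRegularity.NavierStokesRegularity.Theses.SqueezeCycle.ExtremalBiaxialitySubcritical := by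
  intro C m u t₀ x₀ ht₀ hu hGE hmax
  -- the class-uniform gauge strain bound
  obtain ⟨K, hK, hKb⟩ := stub_gaugeStrainBound C
  -- calibration: `C ≥ 0`, `m ≥ 0`
  have hC : 0 ≤ C := squeezeClass_constant_nonneg hu.2.2.2.1
  have hm0 : 0 ≤ m := nonneg_of_maximal hC hmax
  -- the two clauses in `lerayMiddleStrain` form
  obtain ⟨hΛeq, hΛle⟩ := extremal_lerayMiddleStrain_eq ht₀ hu hGE hmax
  by_cases hreg : 1 / 4 ≤ m - 2 * m ^ 3 / K ^ 2
  · -- ## large excess: the open stub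
    exact (stub_largeExcessExclusion C K m u t₀ x₀ hK
      (fun v' hv' t ht x => ⟨hKb v' hv' t ht x, hΛle v' hv' t ht x⟩) hm0 hreg ht₀ hu hΛeq.ge).elim
  · -- ## small excess: bootstrap through the production ceiling
    replace hreg : m - 2 * m ^ 3 / K ^ 2 < 1 / 4 := not_le.1 hreg
    set b : ℝ := m - 2 * m ^ 3 / K ^ 2 with hb
    obtain ⟨h1, h2, h3, h4, h5⟩ := hu
    -- trace-free velocity gradients
    have htr : ∀ t < 0, ∀ x, (stdMatrix (fderiv ℝ (u t) x : ℝ³ →ₗ[ℝ] ℝ³)).trace = 0 := by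
      intro t ht x
      rw [trace_stdMatrix]
      exact h2 t ht x
    -- `6 m² ≤ K²` from the attained value
    have h6 : 6 * m ^ 2 ≤ K ^ 2 := by
      have ht' : 0 < -t₀ := neg_pos.2 ht₀
      set M := stdMatrix (fderiv ℝ (u t₀) x₀ : ℝ³ →ₗ[ℝ] ℝ³) with hM
      have hsix := six_mul_midStrain_sq_le M (htr t₀ ht₀ x₀)
      have hS := hKb u ⟨h1, h2, h3, h4, h5⟩ t₀ ht₀ x₀
      have hΛ : lerayMiddleStrain u t₀ x₀ =
          (-t₀) * (2⁻¹ * (Matrix.isHermitian_add_transpose_self M).eigenvalues₀ 1) :=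
        lerayMiddleStrain_eq_eigenvalues₀
      rw [hΛeq] at hΛ
      -- `m = (-t₀) μ₁ / 2`, so `6 m² = (3/2) (-t₀)² μ₁² ≤ (-t₀)² Σ S² ≤ K²`
      have hKt : ((K / (-t₀)) ^ 2) * (-t₀) ^ 2 = K ^ 2 := by
        have ht0 : t₀ ≠ 0 := ht₀.ne
        field_simp
      set σ := ∑ i, ∑ j, (((1 / 2 : ℝ) • (M + Mᵀ)) i j) ^ 2 with hσ
      set μ := (Matrix.isHermitian_add_transpose_self M).eigenvalues₀ 1 with hμ
      have hσK : σ * (-t₀) ^ 2 ≤ K ^ 2 := by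
        rw [← hKt]
        exact mul_le_mul_of_nonneg_right hS (sq_nonneg _)
      calc 6 * m ^ 2 = (3 / 2 * μ ^ 2) * (-t₀) ^ 2 := by rw [hΛ]; ring
        _ ≤ σ * (-t₀) ^ 2 := mul_le_mul_of_nonneg_right hsix (sq_nonneg _)
        _ ≤ K ^ 2 := hσK
    -- the production ceiling at every point of `u`
    have hceil : ∀ t < 0, ∀ x,
        -4 * (((1 / 2 : ℝ) • (Literature.Analysis.FluidPDE.stdMatrix (fderiv ℝ (u t) x : EuclideanSpace ℝ (Fin 3) →ₗ[ℝ] EuclideanSpace ℝ (Fin 3)) + (Literature.Analysis.FluidPDE.stdMatrix (fderiv ℝ (u t) x : EuclideanSpace ℝ (Fin 3) →ₗ[ℝ] EuclideanSpace ℝ (Fin 3)))ᵀ))).det ≤ (2 * b / (-t)) * (∑ i, ∑ j, (((1 / 2 : ℝ) • (Literature.Analysis.FluidPDE.stdMatrix (fderiv ℝ (u t) x : EuclideanSpace ℝ (Fin 3) →ₗ[ℝ] EuclideanSpace ℝ (Fin 3)) + (Literature.Analysis.FluidPDE.stdMatrix (fderiv ℝ (u t) x : EuclideanSpace ℝ (Fin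 3) →ₗ[ℝ] EuclideanSpace ℝ (Fin 3)))ᵀ)) i j) ^ 2) := by
      intro t ht x
      have ht' : 0 < -t := neg_pos.2 ht
      set M := stdMatrix (fderiv ℝ (u t) x : ℝ³ →ₗ[ℝ] ℝ³) with hM
      -- the ceiling `μ₁ ≤ 2 m / (-t)` from `Λ_u(t,x) ≤ m`
      have hΛle_u : lerayMiddleStrain u t x ≤ m := hΛle u ⟨h1, h2, h3, h4, h5⟩ t ht x
      have hΛ : lerayMiddleStrain u t x =
          (-t) * (2⁻¹ * (Matrix.isHermitian_add_transpose_self M).eigenvalues₀ 1) :=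
        lerayMiddleStrain_eq_eigenvalues₀
      have hμ : (Matrix.isHermitian_add_transpose_self M).eigenvalues₀ 1 ≤ 2 * (m / (-t)) := by
        rw [hΛ] at hΛle_u
        rw [mul_div_assoc', le_div_iff₀ ht']
        nlinarith
      have hmK : 6 * (m / (-t)) ^ 2 ≤ (K / (-t)) ^ 2 := by
        rw [div_pow, div_pow]
        exact (by
          rw [← mul_div_assoc]
          exact div_le_div_of_nonneg_right h6 (sq_nonneg _) :
            6 * (m ^ 2 / (-t) ^ 2) ≤ K ^ 2 / (-t) ^ 2)
      have hcub := stub_cubicProductionBound M (m / (-t)) (K / (-t)) (htr t ht x)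
        (div_nonneg hm0 ht'.le) (div_pos hK ht') hmK hμ (hKb u ⟨h1, h2, h3, h4, h5⟩ t ht x)
      have hcoef : 2 * (m / (-t)) - 4 * (m / (-t)) ^ 3 / (K / (-t)) ^ 2 = 2 * b / (-t) := by
        rw [hb]
        field_simp
        ring
      rw [hcoef] at hcub
      exact hcub
    -- the leaky quarter law kills `u`
    have hz : ∀ t < 0, ∀ x, u t x = 0 :=
      stub_leakyQuarterLawCeiling C b hreg u ⟨h1, h2, h3, h4, h5⟩ hceil
    have hm : m ≤ 0 := nonpos_of_twoFrame_lower_of_slice_zero (hz t₀ ht₀) hGE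
    linarith

end Summit.NavierStokesRegularity.NavierStokesRegularity.Theorems

end
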